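import Literature.NumberTheory.Automorphic.Liu2021.AppendixC.Thm415Pinned
import HarnessLib

/-!
# [Liu 2021, proof of Thm. 4.15] `Hom_{𝔾}(ι∘ρ, H¹_ét)` is contravariant in the oscillator module, and Frobenius
# eigen-identities TRANSFER along a jointly spanning family of equivariant maps

Topic `NumberTheory/Automorphic/Liu2021/AppendixC`; namespace
`Literature.NumberTheory.Automorphic.Liu2021.AppendixC.Sec42Data.EtaleHeckeDatum` (the home of ★ `omegaHom`,
`Thm415Pinned.lean`).  THEOREMS ONLY (no definition, no named fact, no instance, no `sorry`); cell `hodgecm-mathlib`,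
GS-6 hoist glue, node G4 «transfer» (placement row L-9).  Nothing here mentions a Weil representation, a record or a
face — it is the representation-theoretic spine of the see-saw sentence in the printed proof of [Liu2021] Thm. 4.15
(FJcycle.tex l. 2199–2212; print pp. 50–51): «the theta functions of `ω(μ,ε)` restrict along `G⋆ ↪ G` to sums of theta
functions of `U(V⋆)` … Then the theorem follows from the above claim, Remark D.5, and Theorem D.6 (1)» — i.e. a
Frobenius eigen-identity known on every constituent of a decomposition of `ω|_{G⋆}` is an identity on `ω`.
HC_CM is proved only modulo the 7 printed citations until rung 0 closes; this file discharges none of them.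

RESULTS (for an étale Hecke datum `X` of a §4.2 datum `C`, `ι : ℂ ≃ ℚ_ℓ^{ac}`):
* `comp_mem_omegaHom` — **pull-back**: if `j : W′ → W` is `ℂ`-linear and intertwines `ρ′` with `ρ`, then
  `f ∈ Hom_{𝔾}(ι∘ρ, H¹)` gives `f ∘ j ∈ Hom_{𝔾}(ι∘ρ′, H¹)` (so every summand / tensor slice of a decomposition of `ρ`
  inherits the Hom-space condition);
* `eigen_of_forall_comp` — **transfer of a Frobenius eigen-identity**: if a `ℚ_ℓ^{ac}`-linear `T` (e.g.
  `towerRep σ ⊗ 1`) acts by the scalar `c` on the values of EVERY `f′ ∈ Hom_{𝔾}(ι∘ρ_i, H¹)` for a family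
  `(ρ_i, j_i : W_i → W)` of intertwiners whose images SPAN `W`, then `T` acts by `c` on the values of every
  `f ∈ Hom_{𝔾}(ι∘ρ, H¹)` (the set of `w` with `T(f w) = c·f w` is a `ℂ`-submodule containing every `j_i(W_i)`);
* `eigen_of_forall_comp_tmul` — the same along maps out of tensor slices `W_i ⊗ M_i` with `𝔾` acting on the first
  factor only (multiplicity spaces), reduced to the previous one through the slices `w ↦ j_i(w ⊗ m)`.

Companion of ★ `OmegaHomPullback.lean` (transfer DOWN a tower morphism) and ★ `Thm415Pinned.towerRep_comp_mem_omegaHom`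
(Galois preserves the Hom-space); pure linear algebra over the ★ carriers `omegaHom` / `etaleH1Tower`.

## References
* [Liu2021] Y. Liu, *Fourier–Jacobi cycles and arithmetic relative trace formula*, Camb. J. Math. 9 (2021)
  (= arXiv:2102.11518, `FJcycle.tex`): §4.2, the `ℓ`-adic set-up l. 2152–2174 (print pp. 49–50); Thm. 4.15 p. 50,
  proof l. 2185–2213 (print pp. 50–51); Rem. D.5 p. 131; Thm. D.6 (1) p. 132.
-/

set_option autoImplicit false

noncomputable section

open CategoryTheory NumberField
open scoped TensorProduct

namespace Literature.NumberTheory.Automorphic.Liu2021.AppendixC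

variable {F E : Type} [Field F] [NumberField F] [IsTotallyReal F] [Field E] [NumberField E] [Algebra F E]
  [IsTotallyComplex E] [Algebra.IsQuadraticExtension F E]
variable {P5 : PropC5Data F E} {isotropicAt : ℕ → Prop}

namespace Sec42Data.EtaleHeckeDatum

variable {C : Sec42Data P5 isotropicAt} {ℓ : ℕ} [Fact ℓ.Prime] (X : C.EtaleHeckeDatum ℓ) (ι : ℂ ≃+* AlgebraicClosure ℚ_[ℓ])

/-- **Pull-back of the Hom-space along an intertwiner**: for a `ℂ`-linear `j : W′ → W` with `j ∘ ρ′(g) = ρ(g) ∘ j` and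
`f ∈ Hom_{ℚ_ℓ^{ac}[𝔾]}(ι∘ρ, ℚ_ℓ^{ac} ⊗ H¹_ét)`, the composite `f ∘ j` lies in `Hom_{ℚ_ℓ^{ac}[𝔾]}(ι∘ρ′, ℚ_ℓ^{ac} ⊗ H¹_ét)`.
[cite: Liu2021, §4.2 (FJcycle.tex l. 2162–2165; print pp. 49–50); proof of Thm. 4.15 (l. 2199–2212; print pp. 50–51)] -/
theorem comp_mem_omegaHom {W W' : Type} [AddCommGroup W] [Module ℂ W] [AddCommGroup W'] [Module ℂ W']
    (ρW : Representation ℂ C.G W) (ρW' : Representation ℂ C.G W') (j : W' →ₗ[ℂ] W)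
    (hj : ∀ (g : C.G) (w : W'), j (ρW' g w) = ρW g (j w))
    {f : W →ₛₗ[(ι : ℂ →+* AlgebraicClosure ℚ_[ℓ])] AlgebraicClosure ℚ_[ℓ] ⊗[ℚ_[ℓ]] C.etaleH1Tower ℓ} (hf : f ∈ X.omegaHom ι ρW) :
    f.comp j ∈ X.omegaHom ι ρW' := by
  intro g w
  rw [LinearMap.comp_apply, hj, hf g (j w), LinearMap.comp_apply]

/-- **Transfer of a Frobenius eigen-identity along a jointly spanning family of intertwiners.**  Let `T` be `ℚ_ℓ^{ac}`-linear on
`ℚ_ℓ^{ac} ⊗ H¹_ét` and `c ∈ ℚ_ℓ^{ac}`.  If for every member `j_i : W_i → W` of a family of intertwiners `ρ_i → ρ` whose images span `W`,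
`T` acts by `c` on all values of all `f′ ∈ Hom_{𝔾}(ι∘ρ_i, H¹)`, then `T` acts by `c` on all values of every `f ∈ Hom_{𝔾}(ι∘ρ, H¹)`.
[cite: Liu2021, proof of Thm. 4.15 (FJcycle.tex l. 2199–2212; print pp. 50–51)] -/
theorem eigen_of_forall_comp {W : Type} [AddCommGroup W] [Module ℂ W] (ρW : Representation ℂ C.G W)
    {I : Type*} {Wi : I → Type} [∀ i, AddCommGroup (Wi i)] [∀ i, Module ℂ (Wi i)] (ρi : ∀ i, Representation ℂ C.G (Wi i))
    (j : ∀ i, Wi i →ₗ[ℂ] W) (hj : ∀ i (g : C.G) (w : Wi i), j i (ρi i g w) = ρW g (j i w))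
    (hspan : ⊤ ≤ ⨆ i, LinearMap.range (j i))
    (T : AlgebraicClosure ℚ_[ℓ] ⊗[ℚ_[ℓ]] C.etaleH1Tower ℓ →ₗ[AlgebraicClosure ℚ_[ℓ]] AlgebraicClosure ℚ_[ℓ] ⊗[ℚ_[ℓ]] C.etaleH1Tower ℓ)
    (c : AlgebraicClosure ℚ_[ℓ])
    (h : ∀ i, ∀ f' ∈ X.omegaHom ι (ρi i), ∀ w : Wi i, T (f' w) = c • f' w)
    {f : W →ₛₗ[(ι : ℂ →+* AlgebraicClosure ℚ_[ℓ])] AlgebraicClosure ℚ_[ℓ] ⊗[ℚ_[ℓ]] C.etaleH1Tower ℓ} (hf : f ∈ X.omegaHom ι ρW)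
    (w : W) : T (f w) = c • f w := by
  -- the eigen-locus of `f` is a `ℂ`-submodule of `W`
  let S : Submodule ℂ W :=
    { carrier := {w | T (f w) = c • f w}
      zero_mem' := by simp
      add_mem' := fun {a b} ha hb => by
        simp only [Set.mem_setOf_eq] at ha hb ⊢
        rw [map_add, map_add, ha, hb, smul_add]
      smul_mem' := fun a w hw => by
        simp only [Set.mem_setOf_eq] at hw ⊢
        rw [LinearMap.map_smulₛₗ, map_smul, hw, smul_comm] }
  -- containing every `j_i(W_i)` (pull-back + hypothesis)
  have hle : (⨆ i, LinearMap.range (j i)) ≤ S := by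
    refine iSup_le fun i => ?_
    rintro _ ⟨w', rfl⟩
    exact h i (f.comp (j i)) (X.comp_mem_omegaHom ι ρW (ρi i) (j i) (hj i) hf) w'
  exact hle (hspan Submodule.mem_top)

/-- **Transfer along tensor slices with a trivial multiplicity factor**: the same as `eigen_of_forall_comp` for a family
`j_i : W_i ⊗_ℂ M_i → W` intertwining `ρ_i ⊗ 1` with `ρ` whose images span `W` — reduce to the slices `w ↦ j_i(w ⊗ m)`, which
intertwine `ρ_i` with `ρ` and whose images span the image of `j_i`. [cite: Liu2021, proof of Thm. 4.15 (FJcycle.tex l. 2199–2212; print pp. 50–51)] -/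
theorem eigen_of_forall_comp_tmul {W : Type} [AddCommGroup W] [Module ℂ W] (ρW : Representation ℂ C.G W)
    {I : Type*} {Wi Mi : I → Type} [∀ i, AddCommGroup (Wi i)] [∀ i, Module ℂ (Wi i)] [∀ i, AddCommGroup (Mi i)]
    [∀ i, Module ℂ (Mi i)] (ρi : ∀ i, Representation ℂ C.G (Wi i))
    (j : ∀ i, Wi i ⊗[ℂ] Mi i →ₗ[ℂ] W) (hj : ∀ i (g : C.G) (w : Wi i) (m : Mi i), j i (ρi i g w ⊗ₜ m) = ρW g (j i (w ⊗ₜ m)))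
    (hspan : ⊤ ≤ ⨆ i, LinearMap.range (j i))
    (T : AlgebraicClosure ℚ_[ℓ] ⊗[ℚ_[ℓ]] C.etaleH1Tower ℓ →ₗ[AlgebraicClosure ℚ_[ℓ]] AlgebraicClosure ℚ_[ℓ] ⊗[ℚ_[ℓ]] C.etaleH1Tower ℓ)
    (c : AlgebraicClosure ℚ_[ℓ])
    (h : ∀ i, ∀ f' ∈ X.omegaHom ι (ρi i), ∀ w : Wi i, T (f' w) = c • f' w)
    {f : W →ₛₗ[(ι : ℂ →+* AlgebraicClosure ℚ_[ℓ])] AlgebraicClosure ℚ_[ℓ] ⊗[ℚ_[ℓ]] C.etaleH1Tower ℓ} (hf : f ∈ X.omegaHom ι ρW)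
    (w : W) : T (f w) = c • f w := by
  -- slices indexed by `(i, m)`
  refine X.eigen_of_forall_comp ι ρW (I := Σ i, Mi i) (Wi := fun p => Wi p.1) (fun p => ρi p.1)
    (fun p => (j p.1).comp ((TensorProduct.mk ℂ (Wi p.1) (Mi p.1)).flip p.2)) (fun p g w' => ?_) ?_ T c
    (fun p f' hf' w' => h p.1 f' hf' w') hf w
  · simp only [LinearMap.comp_apply, LinearMap.flip_apply, TensorProduct.mk_apply]
    exact hj p.1 g w' p.2
  · -- the slices span: `range (j i) = map (j i) ⊤ = map (j i) (span of pure tensors)`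
    refine hspan.trans (iSup_le fun i => ?_)
    rw [LinearMap.range_eq_map, ← TensorProduct.span_tmul_eq_top, Submodule.map_span, Submodule.span_le]
    rintro _ ⟨_, ⟨w', m, rfl⟩, rfl⟩
    refine Submodule.mem_iSup_of_mem ⟨i, m⟩ ⟨w', ?_⟩
    simp only [LinearMap.comp_apply, LinearMap.flip_apply, TensorProduct.mk_apply]

end Sec42Data.EtaleHeckeDatum

end Literature.NumberTheory.Automorphic.Liu2021.AppendixC

end
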